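import Literature.NumberTheory.LFunctions.WeilFinitePrimeQuadratic
import Literature.NumberTheory.LFunctions.WeilMellinBounds
import HarnessLib

/-!
# RiemannHypothesis / GroundBarta — crux `PolarPerronFrobenius` (stmt-RiemannHypothesis-18390):
# the PRIME-TRUNCATION BARRIER, part 2a/3 — the SYMBOL-BOTTOM UPPER BOUND for every finite-prime truncation

Helper file (`--supports`), RH-free, Mathlib + proved tree files only, no definitions.

For the finite-prime analytic form `E_N` (`Literature.NumberTheory.LFunctions.weilFinitePrimeQuadratic`, frequency weight
`w_N(t) = Re ψ(1/4+it/2) − Σ_{n≤N}(Λ(n)/√n)2cos(t log n)`) and EVERY Weil test `g`: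

`E_N(g) ≤ 2Re(ĝ(0) conj ĝ(1)) + (ψ(1/4) − 2Ψ_N − log π)‖g‖₂² + K_N ‖g'‖₂²`,
`Ψ_N = Σ_{n≤N} Λ(n)/√n`, `K_N = 27 + Σ_{n≤N} (Λ(n)/√n)(log n)²`
(`pt_weilFinitePrimeQuadratic_le`): the weight exceeds its infimum `w_N(0) = ψ(1/4) − 2Ψ_N` by at most
`K_N t²` (`Re ψ(1/4+it/2) − ψ(1/4) ≤ 27t²`, tree; `2 − 2cos x ≤ x²`), and `(1/2π)∫ t²|ĝ(1/2+it)|² dt = ‖g'‖₂²`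
(Plancherel for `g'`, `(g')^(1/2+it) = −it·ĝ(1/2+it)`).  So polar-free tests that are spread at scale `a`
(`‖g'‖² ≲ ‖g‖²/a²`, part 2b) come within `O(1/a²)` of the symbol bottom, below the cone floor of part 1
(`ψ(1/4) − log π + 24/5 − 2Ψ_N`) once the window is large: the barrier of part 3.
Prover B, speedrun unit `sr-gb-rung-b` (rung 3).

References: H. Yoshida, Adv. Stud. Pure Math. 21 (1992) §2 (2.1), §6; E. Bombieri, Rend. Lincei (9) 11 (2000) Thm 2.
-/

set_option linter.dupNamespace false

noncomputable section

open Set MeasureTheory Filter Complex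
open scoped Real Topology ComplexConjugate

namespace Summit.RiemannHypothesis.RiemannHypothesis.Theorems.PolarPerronFrobenius

open Literature.NumberTheory.LFunctions Literature.Analysis.SpecialFunctions

variable {g : ℝ → ℂ}

/-! ## The weight exceeds its infimum by at most `K_N t²` -/

/-- **Quadratic majorant of the finite-prime weight**:
`w_N(t) ≤ ψ(1/4) − 2Ψ_N + (27 + Σ_{n≤N}(Λ(n)/√n)(log n)²) t²`. [cite: Yoshida1992, §6 (vertical series)] -/
theorem pt_weilFinitePrimeWeight_le (N : ℕ) (t : ℝ) :
    weilFinitePrimeWeight N t ≤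
      reDigammaQuarter 0 -
          2 * (∑ n ∈ Finset.range (N + 1), (ArithmeticFunction.vonMangoldt n : ℝ) / Real.sqrt n) +
        (27 + ∑ n ∈ Finset.range (N + 1),
            (ArithmeticFunction.vonMangoldt n : ℝ) / Real.sqrt n * Real.log n ^ 2) * t ^ 2 := by
  unfold weilFinitePrimeWeight weilPrimeRipple
  have h1 := reDigammaQuarter_sub_le t
  have h2 : -(∑ n ∈ Finset.range (N + 1),
        (ArithmeticFunction.vonMangoldt n : ℝ) / Real.sqrt n * (2 * Real.cos (t * Real.log n))) ≤
      -(2 * ∑ n ∈ Finset.range (N + 1), (ArithmeticFunction.vonMangoldt n : ℝ) / Real.sqrt n) +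
        (∑ n ∈ Finset.range (N + 1),
          (ArithmeticFunction.vonMangoldt n : ℝ) / Real.sqrt n * Real.log n ^ 2) * t ^ 2 := by
    rw [Finset.mul_sum, Finset.sum_mul, ← Finset.sum_neg_distrib, ← Finset.sum_neg_distrib,
      ← Finset.sum_add_distrib]
    refine Finset.sum_le_sum fun n _ ↦ ?_
    have h0 : 0 ≤ (ArithmeticFunction.vonMangoldt n : ℝ) / Real.sqrt n :=
      div_nonneg ArithmeticFunction.vonMangoldt_nonneg (Real.sqrt_nonneg _)
    have hc : 2 - 2 * Real.cos (t * Real.log n) ≤ (t * Real.log n) ^ 2 := by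
      have := Real.one_sub_sq_div_two_le_cos (x := t * Real.log n)
      linarith
    have : (ArithmeticFunction.vonMangoldt n : ℝ) / Real.sqrt n * (2 - 2 * Real.cos (t * Real.log n)) ≤
        (ArithmeticFunction.vonMangoldt n : ℝ) / Real.sqrt n * (t * Real.log n) ^ 2 :=
      mul_le_mul_of_nonneg_left hc h0
    nlinarith
  linarith

/-! ## Plancherel for the derivative: `∫ t² |ĝ(1/2+it)|² dt = 2π ‖g'‖₂²` -/

/-- `t² ‖ĝ(1/2+it)‖² = ‖(g')^(1/2+it)‖²` (`(g')^(s) = −(s−1/2) ĝ(s)`). [folklore] -/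
theorem pt_sq_mul_norm_sq_weilMellin (hg : IsWeilTest g) (t : ℝ) :
    t ^ 2 * ‖weilMellin g (1 / 2 + t * I)‖ ^ 2 = ‖weilMellin (deriv g) (1 / 2 + t * I)‖ ^ 2 := by
  rw [weilMellin_deriv hg, norm_mul, mul_pow]
  congr 1
  rw [show -((1 / 2 : ℂ) + t * I - 1 / 2) = ((-t : ℝ) : ℂ) * I by push_cast; ring, norm_mul,
    Complex.norm_I, mul_one, Complex.norm_real, Real.norm_eq_abs, sq_abs, neg_sq]

/-- **Plancherel for the derivative**: `∫ t²‖ĝ(1/2+it)‖² dt = 2π ‖g'‖₂²`. [folklore] -/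
theorem pt_integral_sq_mul_norm_sq_weilMellin (hg : IsWeilTest g) :
    ∫ t : ℝ, ‖weilMellin g (1 / 2 + t * I)‖ ^ 2 * t ^ 2 = 2 * π * weilNorm2Sq (deriv g) := by
  rw [← integral_norm_sq_weilMellin_half_line hg.deriv]
  congr 1 with t
  rw [← pt_sq_mul_norm_sq_weilMellin hg]
  ring

/-! ## The symbol-bottom upper bound -/

/-- **THE SYMBOL-BOTTOM UPPER BOUND (finite-prime truncations).** For every `N` and every Weil test `g`:
`E_N(g) ≤ 2Re(ĝ(0) conj ĝ(1)) + (ψ(1/4) − 2Ψ_N − log π)‖g‖₂² + (27 + Σ_{n≤N}(Λ(n)/√n)(log n)²)‖g'‖₂²`. [cite: Yoshida1992, §2 eq. (2.1), §6] -/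
theorem pt_weilFinitePrimeQuadratic_le (N : ℕ) (hg : IsWeilTest g) :
    weilFinitePrimeQuadratic N g ≤
      2 * (weilMellin g 0 * conj (weilMellin g 1)).re +
        (reDigammaQuarter 0 -
            2 * (∑ n ∈ Finset.range (N + 1), (ArithmeticFunction.vonMangoldt n : ℝ) / Real.sqrt n) -
            Real.log π) * weilNorm2Sq g +
        (27 + ∑ n ∈ Finset.range (N + 1),
            (ArithmeticFunction.vonMangoldt n : ℝ) / Real.sqrt n * Real.log n ^ 2) *
          weilNorm2Sq (deriv g) := by
  set Ψ := ∑ n ∈ Finset.range (N + 1), (ArithmeticFunction.vonMangoldt n : ℝ) / Real.sqrt n with hΨ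
  set K := 27 + ∑ n ∈ Finset.range (N + 1),
      (ArithmeticFunction.vonMangoldt n : ℝ) / Real.sqrt n * Real.log n ^ 2 with hK
  set w₀ := reDigammaQuarter 0 - 2 * Ψ with hw₀
  set F : ℝ → ℝ := fun t ↦ ‖weilMellin g (1 / 2 + t * I)‖ ^ 2 with hF
  have hiF : Integrable F := integrable_norm_sq_weilMellin_half_line hg
  have hiW : Integrable fun t ↦ F t * weilFinitePrimeWeight N t :=
    integrable_norm_sq_weilMellin_mul_weilFinitePrimeWeight hg N
  have hiT : Integrable fun t ↦ F t * t ^ 2 := by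
    have h := integrable_norm_sq_weilMellin_half_line hg.deriv
    refine h.congr (Eventually.of_forall fun t ↦ ?_)
    change ‖weilMellin (deriv g) (1 / 2 + t * I)‖ ^ 2 = ‖weilMellin g (1 / 2 + t * I)‖ ^ 2 * t ^ 2
    rw [← pt_sq_mul_norm_sq_weilMellin hg]
    ring
  have hpt : ∀ t, F t * weilFinitePrimeWeight N t ≤ F t * w₀ + K * (F t * t ^ 2) := by
    intro t
    have h := pt_weilFinitePrimeWeight_le N t
    have hF0 : 0 ≤ F t := sq_nonneg _
    calc F t * weilFinitePrimeWeight N t ≤ F t * (w₀ + K * t ^ 2) := mul_le_mul_of_nonneg_left h hF0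
      _ = F t * w₀ + K * (F t * t ^ 2) := by ring
  have hmono : ∫ t, F t * weilFinitePrimeWeight N t ≤ ∫ t, (F t * w₀ + K * (F t * t ^ 2)) :=
    integral_mono hiW ((hiF.mul_const w₀).add (hiT.const_mul K)) hpt
  have hsplit : ∫ t, (F t * w₀ + K * (F t * t ^ 2)) =
      2 * π * weilNorm2Sq g * w₀ + K * (2 * π * weilNorm2Sq (deriv g)) := by
    rw [integral_add, integral_mul_const, integral_const_mul, integral_norm_sq_weilMellin_half_line hg,
      pt_integral_sq_mul_norm_sq_weilMellin hg]
    · exact hiF.mul_const w₀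
    · exact hiT.const_mul K
  rw [hsplit] at hmono
  have hpi : 0 < 2 * π := by positivity
  unfold weilFinitePrimeQuadratic
  have hA : 1 / (2 * π) * ∫ t, F t * weilFinitePrimeWeight N t ≤
      w₀ * weilNorm2Sq g + K * weilNorm2Sq (deriv g) := by
    have := mul_le_mul_of_nonneg_left hmono (le_of_lt (one_div_pos.2 hpi))
    rw [show 1 / (2 * π) * (2 * π * weilNorm2Sq g * w₀ + K * (2 * π * weilNorm2Sq (deriv g))) =
      w₀ * weilNorm2Sq g + K * weilNorm2Sq (deriv g) by field_simp] at this
    exact this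
  nlinarith [weilNorm2Sq_nonneg g]

/-- Prime-free case: `E(g) ≤ 2Re(ĝ(0) conj ĝ(1)) + (ψ(1/4) − log π)‖g‖₂² + 27‖g'‖₂²` for every Weil test. [cite: Yoshida1992, §2 eq. (2.1), §6] -/
theorem pt_weilFinitePrimeQuadratic_one_le (hg : IsWeilTest g) :
    weilFinitePrimeQuadratic 1 g ≤
      2 * (weilMellin g 0 * conj (weilMellin g 1)).re + (reDigammaQuarter 0 - Real.log π) * weilNorm2Sq g +
        27 * weilNorm2Sq (deriv g) := by
  have h := pt_weilFinitePrimeQuadratic_le 1 hg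
  have h0 : ∑ n ∈ Finset.range (1 + 1), (ArithmeticFunction.vonMangoldt n : ℝ) / Real.sqrt n = 0 :=
    Finset.sum_eq_zero fun n hn ↦ by
      have hn' : n ≤ 1 := by have := Finset.mem_range.1 hn; omega
      interval_cases n <;> simp
  have h0' : ∑ n ∈ Finset.range (1 + 1),
      (ArithmeticFunction.vonMangoldt n : ℝ) / Real.sqrt n * Real.log n ^ 2 = 0 :=
    Finset.sum_eq_zero fun n hn ↦ by
      have hn' : n ≤ 1 := by have := Finset.mem_range.1 hn; omega
      interval_cases n <;> simp
  rw [h0, h0', mul_zero, sub_zero, add_zero] at h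
  exact h

end Summit.RiemannHypothesis.RiemannHypothesis.Theorems.PolarPerronFrobenius
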